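import Mathlib
import Summits.Ventures.PercRepro2.Defs
import Summits.Ventures.PercRepro2.Harris
import Summits.Ventures.PercRepro2.Graph
import Summits.Ventures.PercRepro2.Events
import Summits.Ventures.PercRepro2.TReduction
import Summits.Ventures.PercRepro2.TReductionBase
import Summits.Ventures.PercRepro2.TCrossMin

/-!
# The (T) form from an averaged deletion–contraction inequality at ONE edge (blind cell PercRepro2, mine-a g43)

The one-edge pinning identity of TReduction (`kform_pin`) reads `T(p) = (1 − t)² T₀ + t(1 − t) Φ + t² T₁`
with `T₀ = K_∅(p[g↦0])`, `T₁ = K_∅(p[g↦1])`, `Φ = K_{{g}}(p)`, `t = p g`.  If at SOME free edge `g` the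
cross form dominates the average of the endpoints, `2 Φ ≥ T₀ + T₁`, then
`T(p) ≥ (1 − t)² T₀ + t(1 − t)(T₀ + T₁)/2 + t² T₁ ≥ 0` as soon as `T₀, T₁ ≥ 0`; by induction on the
free edges this gives (T) for every admissible weight vector (`tform_nonneg_of_exists_avg`).  The
antipodal shadow: if every base case `K_D(a)` with `D ≠ ∅` has SOME `g ∈ D` with
`2 K_D(a) ≥ K_{D∖g}(a[g↦0]) + K_{D∖g}(a[g↦1])` (deletion + contraction), every base case is
nonnegative (`kform_nonneg_of_exists_avg`), hence (T_h) (`t_cluster_of_exists_avg`).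

Why one edge suffices: the averaged inequality is exhaustively true at every edge NOT at `h` — in
particular at every edge at the root — on all connected multigraphs with `≤ 5` vertices and `≤ 8`
edges (MINE-A.md §98.3 correction; the only failures are at edges at `h`), and every connected graph
with an edge has an edge at the root.  Nothing here uses the graph.  No instance, no notation.
-/

namespace Summit.Ventures.PercRepro2

namespace TReduction

open Finset

section ExistsAvg

variable {E : Type*} [Fintype E] [DecidableEq E] {R : Type*} [Field R] [LinearOrder R]
  [IsStrictOrderedRing R]

/-- **The one-edge averaged bound**: `T(p) ≥ 0` as soon as `T₀, T₁ ≥ 0` and `T₀ + T₁ ≤ 2 Φ`. -/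
lemma kform_empty_nonneg_of_avg (Q U e : Set (Config E)) (p : E → R) (hp : IsProbVec p) (g : E)
    (h0 : 0 ≤ kform Q U e ∅ (Function.update p g 0))
    (h1 : 0 ≤ kform Q U e ∅ (Function.update p g 1))
    (havg : kform Q U e ∅ (Function.update p g 0) + kform Q U e ∅ (Function.update p g 1) ≤
      2 * kform Q U e {g} p) :
    0 ≤ kform Q U e ∅ p := by
  have hpin := kform_pin Q U e (D := ∅) (g := g) (notMem_empty g) p
  rw [insert_empty] at hpin
  set T₀ := kform Q U e ∅ (Function.update p g 0)
  set T₁ := kform Q U e ∅ (Function.update p g 1)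
  set Φ := kform Q U e {g} p
  have ht0 : 0 ≤ p g := hp.nonneg g
  have ht1 : 0 ≤ 1 - p g := sub_nonneg.2 (hp.le_one g)
  rw [hpin]
  have hΦ' : 0 ≤ p g * (1 - p g) * (Φ - (T₀ + T₁) / 2) :=
    mul_nonneg (mul_nonneg ht0 ht1) (by linarith)
  have hA : 0 ≤ (1 - p g) ^ 2 * T₀ := mul_nonneg (sq_nonneg _) h0
  have hB : 0 ≤ p g ^ 2 * T₁ := mul_nonneg (sq_nonneg _) h1
  have hC : 0 ≤ p g * (1 - p g) * T₀ := mul_nonneg (mul_nonneg ht0 ht1) h0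
  have hD : 0 ≤ p g * (1 - p g) * T₁ := mul_nonneg (mul_nonneg ht0 ht1) h1
  nlinarith [hΦ', hA, hB, hC, hD]

/-- **(T) from an averaged cross inequality at one free edge**: if every admissible `p` with a free
edge has SOME free edge `g` with `K_∅(p[g↦0]) + K_∅(p[g↦1]) ≤ 2 K_{{g}}(p)`, then `K_∅(p) ≥ 0` for
every admissible `p`. -/
theorem kform_empty_nonneg_of_exists_avg (Q U e : Set (Config E))
    (havg : ∀ (p : E → R), IsProbVec p → (freeEdges ∅ p).Nonempty →
      ∃ g ∈ freeEdges ∅ p, kform Q U e ∅ (Function.update p g 0)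
        + kform Q U e ∅ (Function.update p g 1) ≤ 2 * kform Q U e {g} p) :
    ∀ (p : E → R), IsProbVec p → 0 ≤ kform Q U e ∅ p := by
  suffices h : ∀ n : ℕ, ∀ (p : E → R), IsProbVec p → (freeEdges ∅ p).card = n →
      0 ≤ kform Q U e ∅ p from fun p hp => h _ p hp rfl
  intro n
  induction n with
  | zero =>
    intro p hp hn
    have ha : ∀ x, p x = 0 ∨ p x = 1 := by
      intro x
      by_cases h0 : p x = 0
      · exact Or.inl h0
      by_cases h1 : p x = 1
      · exact Or.inr h1
      exfalso
      have hmem : x ∈ freeEdges ∅ p := mem_freeEdges.2 ⟨notMem_empty x, h0, h1⟩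
      rw [card_eq_zero] at hn
      rw [hn] at hmem
      exact notMem_empty x hmem
    rw [kform_empty_of_zero_one Q U e ha]
  | succ n ih =>
    intro p hp hn
    have hne : (freeEdges ∅ p).Nonempty := by
      rw [← card_pos, hn]; exact Nat.succ_pos n
    obtain ⟨g, hg, hge⟩ := havg p hp hne
    have hcard : ((freeEdges ∅ p).erase g).card = n := by
      rw [card_erase_of_mem hg, hn]; rfl
    have h0 : 0 ≤ kform Q U e ∅ (Function.update p g 0) :=
      ih _ (hp.update g le_rfl zero_le_one) (by rw [freeEdges_update ∅ p hg (Or.inl rfl), hcard])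
    have h1 : 0 ≤ kform Q U e ∅ (Function.update p g 1) :=
      ih _ (hp.update g zero_le_one le_rfl) (by rw [freeEdges_update ∅ p hg (Or.inr rfl), hcard])
    exact kform_empty_nonneg_of_avg Q U e p hp g h0 h1 hge

/-- **(T) for arbitrary events from the averaged cross inequality at one free edge.** -/
theorem tform_nonneg_of_exists_avg (Q U e : Set (Config E))
    (havg : ∀ (p : E → R), IsProbVec p → (freeEdges ∅ p).Nonempty →
      ∃ g ∈ freeEdges ∅ p, kform Q U e ∅ (Function.update p g 0)
        + kform Q U e ∅ (Function.update p g 1) ≤ 2 * kform Q U e {g} p)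
    (p : E → R) (hp : IsProbVec p) :
    prob p (Q ∩ U) * prob p e + prob p (Q ∩ e) * prob p U ≤
      prob p (Q ∩ U ∩ e) + prob p Q * prob p (U ∩ e) := by
  have h := kform_empty_nonneg_of_exists_avg Q U e havg p hp
  rw [kform_empty] at h
  unfold gform at h
  linarith

/-- **Every antipodal base case is nonnegative from the averaged deletion–contraction inequality at
one edge**: if every base case `K_D(a)` with `D ≠ ∅` has some `g ∈ D` with
`K_{D∖g}(a[g↦0]) + K_{D∖g}(a[g↦1]) ≤ 2 K_D(a)`, every base case is nonnegative. -/
theorem kform_nonneg_of_exists_avg (Q U e : Set (Config E))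
    (havg : ∀ (D : Finset E) (a : E → R), IsProbVec a → (∀ x, x ∉ D → a x = 0 ∨ a x = 1) →
      D.Nonempty → ∃ g ∈ D, kform Q U e (D.erase g) (Function.update a g 0)
        + kform Q U e (D.erase g) (Function.update a g 1) ≤ 2 * kform Q U e D a) :
    ∀ (D : Finset E) (a : E → R), IsProbVec a → (∀ x, x ∉ D → a x = 0 ∨ a x = 1) →
      0 ≤ kform Q U e D a := by
  intro D
  induction D using Finset.strongInduction with
  | H D ih =>
    intro a ha hzo
    rcases D.eq_empty_or_nonempty with hD | hne
    · subst hD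
      rw [kform_empty_of_zero_one Q U e (fun x => hzo x (notMem_empty x))]
    · obtain ⟨g, hg, hge⟩ := havg D a ha hzo hne
      have herase : D.erase g ⊂ D := erase_ssubset hg
      have hz0 : ∀ x, x ∉ D.erase g → Function.update a g 0 x = 0 ∨ Function.update a g 0 x = 1 := by
        intro x hx
        by_cases hxg : x = g
        · subst hxg; simp
        · rw [Function.update_of_ne hxg]
          exact hzo x (fun hxD => hx (mem_erase.2 ⟨hxg, hxD⟩))
      have hz1 : ∀ x, x ∉ D.erase g → Function.update a g 1 x = 0 ∨ Function.update a g 1 x = 1 := by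
        intro x hx
        by_cases hxg : x = g
        · subst hxg; simp
        · rw [Function.update_of_ne hxg]
          exact hzo x (fun hxD => hx (mem_erase.2 ⟨hxg, hxD⟩))
      have h0 := ih _ herase _ (ha.update g le_rfl zero_le_one) hz0
      have h1 := ih _ herase _ (ha.update g zero_le_one le_rfl) hz1
      linarith

/-- **(T) for arbitrary events from the averaged inequality on the base cases.** -/
theorem tform_nonneg_of_exists_avg' (Q U e : Set (Config E))
    (havg : ∀ (D : Finset E) (a : E → R), IsProbVec a → (∀ x, x ∉ D → a x = 0 ∨ a x = 1) →
      D.Nonempty → ∃ g ∈ D, kform Q U e (D.erase g) (Function.update a g 0)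
        + kform Q U e (D.erase g) (Function.update a g 1) ≤ 2 * kform Q U e D a)
    (p : E → R) (hp : IsProbVec p) :
    prob p (Q ∩ U) * prob p e + prob p (Q ∩ e) * prob p U ≤
      prob p (Q ∩ U ∩ e) + prob p Q * prob p (U ∩ e) :=
  tform_nonneg_of_base Q U e (kform_nonneg_of_exists_avg Q U e havg) p hp

end ExistsAvg

section Cluster

variable {V : Type*} {E : Type*} [Fintype E] [DecidableEq E]
  {R : Type*} [Field R] [LinearOrder R] [IsStrictOrderedRing R]

/-- **(T_h) for cluster events from the averaged inequality at one edge per base case** (the shape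
of `t_cluster_of_antipodal_base`). -/
theorem t_cluster_of_exists_avg (p : E → R) (hp : IsProbVec p) (ends : E → Sym2 V) (s h : V)
    (𝓤 𝓥 : Set (Set V))
    (havg : ∀ (D : Finset E) (a : E → R), IsProbVec a → (∀ x, x ∉ D → a x = 0 ∨ a x = 1) →
      D.Nonempty → ∃ g ∈ D,
        kform (clusterInEvent ends s {T : Set V | h ∈ T}) (clusterInEvent ends s 𝓤)
            (clusterInEvent ends s 𝓥) (D.erase g) (Function.update a g 0)
          + kform (clusterInEvent ends s {T : Set V | h ∈ T}) (clusterInEvent ends s 𝓤)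
            (clusterInEvent ends s 𝓥) (D.erase g) (Function.update a g 1) ≤
        2 * kform (clusterInEvent ends s {T : Set V | h ∈ T}) (clusterInEvent ends s 𝓤)
          (clusterInEvent ends s 𝓥) D a) :
    let Q := clusterInEvent ends s {T : Set V | h ∈ T}
    let U := clusterInEvent ends s 𝓤
    let e := clusterInEvent ends s 𝓥
    prob p (Q ∩ U) * prob p e + prob p U * prob p (Q ∩ e) ≤
      prob p (Q ∩ U ∩ e) + prob p Q * prob p (U ∩ e) := by
  intro Q U e
  have h := tform_nonneg_of_exists_avg' Q U e havg p hp
  linarith [mul_comm (prob p U) (prob p (Q ∩ e))]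

end Cluster

end TReduction

end Summit.Ventures.PercRepro2
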